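/- Ideator `ym-idea-2` (g15): helper for LINE-17 (⟨stmt-QuantumFields-24003⟩ `BoxMidWindowsSU22`, stubs E `stub_tiltMoments` (2) and F `stub_gaussSideTerms` (iii))
   and LINE-18 v5 (⟨stmt-QuantumFields-24006⟩, S6/S7): the «K ⪯ I» / Bessel step named in STUB-MAP-24003-v3 §E(2). -/
import Summits.QuantumFields.YangMills.Theorems.WeakCouplingRatesColdBoxPlaqVariance
import Summits.QuantumFields.YangMills.Theorems.WeakCouplingRatesColdBoxDirichletPosDef
import Summits.QuantumFields.YangMills.Theorems.WeakCouplingRatesDefs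

/-!
# Route `AllWindowsColdBox`: the Dirichlet projection kernel is a contraction (`K ⪯ I` as a quadratic form on plaquette weights)

For any pinned lattice-Maxwell precision matrix `Q = Σ_p λ_pλ_pᵀ` (`LatticeMaxwell.Qmat pin a n`, positive definite) and any real weights
`w` on the plaquettes of the box, the vector `v = Σ_p w_p λ_p` satisfies `vᵀ Q⁻¹ v ≤ Σ_p w_p²`
(`dotProduct_sum_coeff_inv_mulVec_le_sum_sq`; proof: with `u = Q⁻¹v`, `v·u = uᵀQu = Σ_p (λ_p·u)²` and `v·u = Σ_p w_p(λ_p·u)`, so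
Cauchy–Schwarz gives `(v·u)² ≤ (Σ w²)(v·u)`).  Equivalently the kernel `K_pq = λ_p·Q⁻¹λ_q` — for the temporal-gauge Dirichlet Gaussian of the
cold box this is `boxDirProjKernel H` — is the orthogonal projection onto the row space of the edge–plaquette incidence, hence
`Σ_{p,q} w_p w_q K_pq ≤ Σ_p w_p²` (`sum_sum_mul_boxDirProjKernel_le_sum_sq`), generalising the diagonal bound `K_pp ≤ 1`
(`dotProduct_coeff_inv_mulVec_coeff_le_one`, `integral_dirCirc_sq_le_one`).  This is the «K ⪯ I / Bessel» input of the Wick-sum bounds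
of LINE-17's obligations E(2) (variance of the cubic chaos of the tilt) and F(iii), where a plaquette sum `Σ_{p'} K_{pp'}K_{qp'}` or a
quadratic form `Σ_{pq} a_p a_q K_pq M_pq` must not cost a volume factor.
Everything proved; no definition; standard axioms.  Nothing about the Yang–Mills mass gap is proved here.
-/

set_option autoImplicit false

noncomputable section

open MeasureTheory Matrix Finset
open Literature.MathematicalPhysics.QuantumFieldTheory
open Literature.MathematicalPhysics.QuantumFieldTheory.LatticeMaxwell
open Literature.MathematicalPhysics.QuantumFieldTheory.AxialGauge
open Literature.Probability.LatticeModels (halfOpenBox)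

namespace Summit.QuantumFields.YangMills.Theorems.WeakCouplingRates

section General

variable {d : ℕ} {pin : Literature.MathematicalPhysics.QuantumLattice.ZdEdge d → Prop} [DecidablePred pin]
  {a : Literature.Probability.LatticeModels.Site d} {n : ℕ}

/-- **Weighted Bessel / projection bound.**  For positive definite `Q = Σ_p λ_pλ_pᵀ` and weights `w` on the box plaquettes,
`v = Σ_p w_p λ_p` has `vᵀQ⁻¹v ≤ Σ_p w_p²`. -/
theorem dotProduct_sum_coeff_inv_mulVec_le_sum_sq (hQ : (Qmat pin a n).PosDef) (w : Plaq d → ℝ) :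
    (∑ p ∈ plaquettesIn (halfOpenBox d n), w p • coeff pin a n (Plaq.shift a p)) ⬝ᵥ
        (Qmat pin a n)⁻¹ *ᵥ (∑ p ∈ plaquettesIn (halfOpenBox d n), w p • coeff pin a n (Plaq.shift a p)) ≤
      ∑ p ∈ plaquettesIn (halfOpenBox d n), w p ^ 2 := by
  classical
  set B := plaquettesIn (halfOpenBox d n) with hB
  set Q := Qmat pin a n with hQdef
  set v := ∑ p ∈ B, w p • coeff pin a n (Plaq.shift a p) with hv
  set u := Q⁻¹ *ᵥ v with hu
  have hQu : Q *ᵥ u = v := by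
    rw [hu, mulVec_mulVec, mul_nonsing_inv _ ((isUnit_iff_isUnit_det Q).1 hQ.isUnit), one_mulVec]
  -- `v·u = uᵀQu = Σ_p (λ_p·u)²`
  have h1 : v ⬝ᵥ u = ∑ p ∈ B, (coeff pin a n (Plaq.shift a p) ⬝ᵥ u) ^ 2 := by
    have : v ⬝ᵥ u = u ⬝ᵥ Q *ᵥ u := by rw [hQu, dotProduct_comm]
    rw [this, hQdef, dotProduct_Qmat_mulVec, formM_zero_eq]
  -- `v·u = Σ_p w_p (λ_p·u)`
  have h2 : v ⬝ᵥ u = ∑ p ∈ B, w p * (coeff pin a n (Plaq.shift a p) ⬝ᵥ u) := by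
    rw [hv, dotProduct_comm, dotProduct_sum]
    refine Finset.sum_congr rfl fun p _ => ?_
    rw [dotProduct_smul, smul_eq_mul, dotProduct_comm]
  -- Cauchy–Schwarz
  have h3 : (v ⬝ᵥ u) ^ 2 ≤ (∑ p ∈ B, w p ^ 2) * ∑ p ∈ B, (coeff pin a n (Plaq.shift a p) ⬝ᵥ u) ^ 2 := by
    rw [h2]
    exact Finset.sum_mul_sq_le_sq_mul_sq B w fun p => coeff pin a n (Plaq.shift a p) ⬝ᵥ u
  rw [← h1] at h3
  have hW : 0 ≤ ∑ p ∈ B, w p ^ 2 := Finset.sum_nonneg fun p _ => sq_nonneg _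
  have h0 : 0 ≤ v ⬝ᵥ u := by rw [h1]; exact Finset.sum_nonneg fun p _ => sq_nonneg _
  by_contra hlt
  push Not at hlt
  have hpos : 0 < v ⬝ᵥ u := lt_of_le_of_lt hW hlt
  have : (v ⬝ᵥ u) * (v ⬝ᵥ u) ≤ (∑ p ∈ B, w p ^ 2) * (v ⬝ᵥ u) := by rw [← sq]; exact h3
  have := le_of_mul_le_mul_right this hpos
  linarith

end General

/-! ## Instance: the Dirichlet projection kernel of the cold box -/

section Dirichlet

variable (H : ℕ)

/-- **`K ⪯ I` for the Dirichlet projection kernel**: for all real weights `w` on the plaquettes of the enlarged box,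
`Σ_{p,q} w_p w_q · boxDirProjKernel H (p + dirCorner) (q + dirCorner) ≤ Σ_p w_p²`. -/
theorem sum_sum_mul_boxDirProjKernel_le_sum_sq (w : Plaq 4 → ℝ) :
    ∑ p ∈ plaquettesIn (halfOpenBox 4 (2 * H + 3)), ∑ q ∈ plaquettesIn (halfOpenBox 4 (2 * H + 3)),
        w p * w q * boxDirProjKernel H (Plaq.shift dirCorner p) (Plaq.shift dirCorner q) ≤
      ∑ p ∈ plaquettesIn (halfOpenBox 4 (2 * H + 3)), w p ^ 2 := by
  classical
  have h := dotProduct_sum_coeff_inv_mulVec_le_sum_sq (posDef_dirQmat H) w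
  set B := plaquettesIn (halfOpenBox 4 (2 * H + 3))
  set Q := Qmat (fun e => e ∉ dirFreeEdges H) dirCorner (2 * H + 3)
  set lam : Plaq 4 → (Free (fun e => e ∉ dirFreeEdges H) dirCorner (2 * H + 3) → ℝ) :=
    fun p => coeff (fun e => e ∉ dirFreeEdges H) dirCorner (2 * H + 3) (Plaq.shift dirCorner p) with hlam
  have hexp : (∑ p ∈ B, w p • lam p) ⬝ᵥ Q⁻¹ *ᵥ (∑ q ∈ B, w q • lam q) =
      ∑ p ∈ B, ∑ q ∈ B, w p * w q * (lam p ⬝ᵥ Q⁻¹ *ᵥ lam q) := by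
    have hQv : Q⁻¹ *ᵥ (∑ q ∈ B, w q • lam q) = ∑ q ∈ B, w q • (Q⁻¹ *ᵥ lam q) := by
      rw [Matrix.mulVec_sum]
      exact Finset.sum_congr rfl fun q _ => Matrix.mulVec_smul _ _ _
    rw [hQv, dotProduct_comm, dotProduct_sum]
    refine Finset.sum_congr rfl fun p _ => ?_
    rw [dotProduct_smul, dotProduct_comm, dotProduct_sum, smul_eq_mul, Finset.mul_sum]
    refine Finset.sum_congr rfl fun q _ => ?_
    rw [dotProduct_smul, smul_eq_mul]
    ring
  have : ∀ p q : Plaq 4, boxDirProjKernel H (Plaq.shift dirCorner p) (Plaq.shift dirCorner q) = lam p ⬝ᵥ Q⁻¹ *ᵥ lam q :=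
    fun p q => rfl
  simp_rw [this]
  rw [← hexp]
  exact h

/-- The same bound for weights supported on a sub-family `S` of box plaquettes (extend by zero). -/
theorem sum_sum_mul_boxDirProjKernel_le_sum_sq_of_subset (S : Finset (Plaq 4))
    (hS : S ⊆ plaquettesIn (halfOpenBox 4 (2 * H + 3))) (w : Plaq 4 → ℝ) :
    ∑ p ∈ S, ∑ q ∈ S, w p * w q * boxDirProjKernel H (Plaq.shift dirCorner p) (Plaq.shift dirCorner q) ≤
      ∑ p ∈ S, w p ^ 2 := by
  classical
  have h := sum_sum_mul_boxDirProjKernel_le_sum_sq H (fun p => if p ∈ S then w p else 0)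
  have hL : ∑ p ∈ plaquettesIn (halfOpenBox 4 (2 * H + 3)), ∑ q ∈ plaquettesIn (halfOpenBox 4 (2 * H + 3)),
      (if p ∈ S then w p else 0) * (if q ∈ S then w q else 0) *
        boxDirProjKernel H (Plaq.shift dirCorner p) (Plaq.shift dirCorner q) =
      ∑ p ∈ S, ∑ q ∈ S, w p * w q * boxDirProjKernel H (Plaq.shift dirCorner p) (Plaq.shift dirCorner q) := by
    rw [← Finset.sum_subset hS]
    · refine Finset.sum_congr rfl fun p hp => ?_
      rw [← Finset.sum_subset hS]
      · exact Finset.sum_congr rfl fun q hq => by simp [hp, hq]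
      · intro q _ hq; simp [hq]
    · intro p _ hp; simp [hp]
  have hR : ∑ p ∈ plaquettesIn (halfOpenBox 4 (2 * H + 3)), (if p ∈ S then w p else 0) ^ 2 = ∑ p ∈ S, w p ^ 2 := by
    rw [← Finset.sum_subset hS]
    · exact Finset.sum_congr rfl fun p hp => by simp [hp]
    · intro p _ hp; simp [hp]
  rw [hL, hR] at h
  exact h

/-- **No volume factor against a Gram matrix** (`tr(K M) ≤ tr M` for `0 ⪯ K ⪯ I` and `M = BᵀB ⪰ 0`): for any finite family of
weight vectors `B k` on a sub-family `S` of box plaquettes,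
`Σ_{p,q∈S} K_pq · (Σ_k B_k(p) B_k(q)) ≤ Σ_{p∈S} Σ_k B_k(p)²` — the form in which the Wick sums of LINE-17's obligations E(2)/F(iii) use
`K ⪯ I` (there `M_pq` is a product of link–link covariances between the links of `p` and of `q`, a Gram matrix by Wick's formula). -/
theorem sum_sum_boxDirProjKernel_mul_gram_le {ι : Type*} (T : Finset ι) (S : Finset (Plaq 4))
    (hS : S ⊆ plaquettesIn (halfOpenBox 4 (2 * H + 3))) (B : ι → Plaq 4 → ℝ) :
    ∑ p ∈ S, ∑ q ∈ S, boxDirProjKernel H (Plaq.shift dirCorner p) (Plaq.shift dirCorner q) * ∑ k ∈ T, B k p * B k q ≤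
      ∑ p ∈ S, ∑ k ∈ T, B k p ^ 2 := by
  classical
  have hswap : ∑ p ∈ S, ∑ q ∈ S, boxDirProjKernel H (Plaq.shift dirCorner p) (Plaq.shift dirCorner q) * ∑ k ∈ T, B k p * B k q =
      ∑ k ∈ T, ∑ p ∈ S, ∑ q ∈ S, B k p * B k q * boxDirProjKernel H (Plaq.shift dirCorner p) (Plaq.shift dirCorner q) := by
    calc ∑ p ∈ S, ∑ q ∈ S, boxDirProjKernel H (Plaq.shift dirCorner p) (Plaq.shift dirCorner q) * ∑ k ∈ T, B k p * B k q
        = ∑ p ∈ S, ∑ q ∈ S, ∑ k ∈ T, B k p * B k q * boxDirProjKernel H (Plaq.shift dirCorner p) (Plaq.shift dirCorner q) := by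
          refine Finset.sum_congr rfl fun p _ => Finset.sum_congr rfl fun q _ => ?_
          rw [Finset.mul_sum]
          exact Finset.sum_congr rfl fun k _ => by ring
      _ = ∑ p ∈ S, ∑ k ∈ T, ∑ q ∈ S, B k p * B k q * boxDirProjKernel H (Plaq.shift dirCorner p) (Plaq.shift dirCorner q) :=
          Finset.sum_congr rfl fun p _ => Finset.sum_comm
      _ = ∑ k ∈ T, ∑ p ∈ S, ∑ q ∈ S, B k p * B k q * boxDirProjKernel H (Plaq.shift dirCorner p) (Plaq.shift dirCorner q) :=
          Finset.sum_comm
  rw [hswap]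
  calc ∑ k ∈ T, ∑ p ∈ S, ∑ q ∈ S, B k p * B k q * boxDirProjKernel H (Plaq.shift dirCorner p) (Plaq.shift dirCorner q)
      ≤ ∑ k ∈ T, ∑ p ∈ S, B k p ^ 2 :=
        Finset.sum_le_sum fun k _ => sum_sum_mul_boxDirProjKernel_le_sum_sq_of_subset H S hS (B k)
    _ = ∑ p ∈ S, ∑ k ∈ T, B k p ^ 2 := Finset.sum_comm

/-- **Probabilistic reading: variances of weighted circulation sums are at most the sum of squared weights** under the Dirichlet
Gaussian `boxDirichlet H`: `E_D[(Σ_{p∈S} w_p s(p + dirCorner))²] ≤ Σ_{p∈S} w_p²` for every family `S` of plaquettes of the enlarged box. -/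
theorem integral_sq_sum_mul_dirCirc_le_sum_sq (S : Finset (Plaq 4))
    (hS : S ⊆ plaquettesIn (halfOpenBox 4 (2 * H + 3))) (w : Plaq 4 → ℝ) :
    ∫ s, (∑ p ∈ S, w p * dirCirc H (Plaq.shift dirCorner p) s) ^ 2 ∂(boxDirichlet H) ≤ ∑ p ∈ S, w p ^ 2 := by
  classical
  have hint : ∀ p q : Plaq 4, Integrable (fun s => dirCirc H (Plaq.shift dirCorner p) s * dirCirc H (Plaq.shift dirCorner q) s)
      (boxDirichlet H) := fun p q =>
    ((isGaussianProcess_dirCirc H).hasGaussianLaw_eval _).memLp_two.integrable_mul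
      ((isGaussianProcess_dirCirc H).hasGaussianLaw_eval _).memLp_two
  have hexp : ∀ s, (∑ p ∈ S, w p * dirCirc H (Plaq.shift dirCorner p) s) ^ 2 =
      ∑ p ∈ S, ∑ q ∈ S, w p * w q * (dirCirc H (Plaq.shift dirCorner p) s * dirCirc H (Plaq.shift dirCorner q) s) := by
    intro s
    rw [sq, Finset.sum_mul_sum]
    exact Finset.sum_congr rfl fun p _ => Finset.sum_congr rfl fun q _ => by ring
  simp_rw [hexp]
  rw [integral_finsetSum _ fun p _ => integrable_finsetSum _ fun q _ => (hint p q).const_mul _]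
  have hstep : ∀ p ∈ S, ∫ s, ∑ q ∈ S, w p * w q * (dirCirc H (Plaq.shift dirCorner p) s * dirCirc H (Plaq.shift dirCorner q) s)
      ∂(boxDirichlet H) = ∑ q ∈ S, w p * w q * boxDirProjKernel H (Plaq.shift dirCorner p) (Plaq.shift dirCorner q) := by
    intro p _
    rw [integral_finsetSum _ fun q _ => (hint p q).const_mul _]
    refine Finset.sum_congr rfl fun q _ => ?_
    rw [integral_const_mul, integral_dirCirc_mul]
    rfl
  rw [Finset.sum_congr rfl hstep]
  exact sum_sum_mul_boxDirProjKernel_le_sum_sq_of_subset H S hS w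

end Dirichlet

end Summit.QuantumFields.YangMills.Theorems.WeakCouplingRates

end
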